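import Summits.QuantumFields.YangMills.Theorems.AllWindowsColdBoxBoxHighLineConnectedFourPointCubic
import Summits.QuantumFields.YangMills.Theorems.AllWindowsColdBoxBoxHighLineRestrictionSetCum4
import Summits.QuantumFields.YangMills.Theorems.AllWindowsColdBoxBoxHighLinePlaqCostSizesOnD
import Summits.QuantumFields.YangMills.Theorems.AllWindowsColdBoxBoxHighLineWilsonPlaquetteTaylorCore
import Summits.QuantumFields.YangMills.Theorems.AllWindowsColdBoxBoxHighLineEdgeChartParity

/-!
# `ConnectedFourPoint`, cubic pair — ON THE CUT SMALL-FIELD SET `μ_{D′}`: `|κ₄,₀^{μ_{D′}}(L₀, L_T; P, P)| ≤ C·B²·(1+log H)⁷·(1 + √τ·H⁴)/β³`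

LEAD seat `ym-line-sfw-p2` (g78), cell ym-idea-1; U5 prep, helper-grade (planner ym-idea-2 g18 routing 2026-08-30T00:27:41Z, K4′ (a): «the μ_{D′} ↔ E₀ transfer of the
exact piece»).  The EXACT cubic-pair term of `f″(0) = κ₄,₀` is consumed by the U5 assembler on the restricted Gaussian `μ_{D′}`, `D′ ⊆ smallField H s` measurable with
Gaussian co-mass `E₀[1 − 1_{D′}] ≤ τ ≤ 1/2` (fcl-p3 g27's letters ✓`GaussRestrict.*`).  This file moves ✓`abs_cum4_linCurvSq_cubicPair_le` (the size under the full
Gaussian `E₀`) onto `μ_{D′}`: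

★★ `abs_tiltCum4_muSet_cubicPair_le` — `∃ C ≥ 0, ∀ H ≥ 1, β > 0, B, |T_p| ≤ B, x₀ x_T, 0 ≤ s, D ⊆ smallField H s measurable, E₀[1 − 1_D] ≤ τ ≤ 1/2:`
  `|Tilt.tiltCum4 μ_D P 0 L₀ L_T| ≤ C·B²·(1+log H)⁷·(1 + √τ·H⁴)/β³`,  `P = β·Σ_p tripleForm (T p)(plaqVar_p)`, `L_z = linCurvSq H (plaq12At z)`
(at `t = 0` the tilt slot of `tiltCum4` is free, so `P` sits in the `U`-slot: `tiltCum4 μ_D P 0 L₀ L_T = κ₄^{μ_D}(L₀, L_T; P, P)`).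
Route: ✓`GaussRestrict.abs_tiltCum4_muSet_zero_sub_gaussAvg_centred_le` (fcl-p3 g27) with the eleven Gaussian sizes supplied as PERFECT SQUARES from Bonami–Nelson
✓`gaussAvg_sq_mul_sq_le_of_polyCert` (`L̃` degree 2: ✓`gaussAvg_centred_linCurvSq_sq_le`; `P` degree 3: ✓`tripleBond_gaussAvg_le`) — transfer error
`√τ·313808·a₁·a₃`, `a₁ = C_V(1+log H)²/β²`, `a₃ = C_T B²H⁴(1+log H)³/β`; parity (`P` odd: `tripleForm_neg`; ✓`gaussAvg_eq_zero_of_odd`, ✓`gaussAvg_mul_eq_zero_of_even_odd`)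
kills `E₀P` and `E₀[L̃P]`, so the `E₀`-side is exactly ✓C4's quantity.

Tree only + Mathlib; no definitions; standard axioms.  HONEST LABEL: glue for the RECORDED lift L3 of the NEXT rung U5 (⟨stmt-QuantumFields-24336⟩, UNSTAFFED; the rest of K4′ —
the other `κ₄,₀` slots by Hölder — is NOT here); ⟨24004⟩ ⟨24336⟩ and this seat's crux ⟨stmt-QuantumFields-22884⟩ remain OPEN; route AllWindowsColdBox is DRAFT; no crux,
rung or summit is proved; **the Yang–Mills mass gap is NOT proved by this file; no summit is proved by a line.**
-/

set_option autoImplicit false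

noncomputable section

open MeasureTheory Matrix Finset
open Literature.Probability.LatticeModels (Site)
open Literature.MathematicalPhysics.QuantumLattice (ZdPlaquette plaquettesTouching)
open Literature.MathematicalPhysics.QuantumFieldTheory.AxialGauge (boxEdges)
open Summit.QuantumFields.YangMills.Theorems.WeakCouplingRates (plaq12At)

namespace Summit.QuantumFields.YangMills.Theorems.AllWindowsColdBoxBoxHighLine

namespace EdgeChartGaussian

open LaplaceSandwich (flatten)

/-- The triple-product form is odd: `tripleForm T (−v) = −tripleForm T v`. -/
theorem tripleForm_neg (T : Fin 4 → Fin 4 → Fin 4 → ℝ) (v : Fin 4 → E3) :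
    tripleForm T (fun i => -v i) = -tripleForm T v := by
  unfold tripleForm
  simp only [WithLp.ofLp_neg, map_neg, LinearMap.neg_apply, neg_neg, neg_dotProduct, mul_neg, Finset.sum_neg_distrib]

/-- The triple-product vertex sum `β·Σ_p tripleForm (T p) (plaqVar_p a)` is odd in `a`. -/
theorem tripleFormSum_neg (H : ℕ) (β : ℝ) (S : Finset (ZdPlaquette 4)) (T : ZdPlaquette 4 → Fin 4 → Fin 4 → Fin 4 → ℝ) (a : LandauFree H → E3) :
    β * ∑ p ∈ S, tripleForm (T p) (plaqVar H p.1 p.2.1.1 p.2.1.2 (-a)) = -(β * ∑ p ∈ S, tripleForm (T p) (plaqVar H p.1 p.2.1.1 p.2.1.2 a)) := by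
  have h : ∀ p : ZdPlaquette 4, plaqVar H p.1 p.2.1.1 p.2.1.2 (-a) = fun i => -plaqVar H p.1 p.2.1.1 p.2.1.2 a i :=
    fun p => funext fun i => WilsonTaylor.plaqVar_neg H p.1 p.2.1.1 p.2.1.2 a i
  simp only [h, tripleForm_neg, Finset.sum_neg_distrib, mul_neg]

/-- A certified polynomial chart observable is measurable. -/
theorem measurable_of_polyCert {H : ℕ} {F : (LandauFree H → E3) → ℝ} {d : ℕ}
    (hF : ∃ Q : MvPolynomial (LandauFree H × Fin 3) ℝ, Q.totalDegree ≤ d ∧ ∀ a, F a = MvPolynomial.eval (flatten (LandauFree H) a) Q) :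
    Measurable F := by
  obtain ⟨Q, -, hQ⟩ := hF
  have h : F = fun a => MvPolynomial.eval (flatten (LandauFree H) a) Q := funext hQ
  rw [h]
  exact (MvPolynomial.continuous_eval Q).measurable.comp (flatten (LandauFree H)).measurable


/-! ## The cubic pair on `μ_{D′}` -/

/-- ★★ **The exact cubic pair of `κ₄,₀` on the cut small-field set** (see the module docstring). -/
theorem abs_tiltCum4_muSet_cubicPair_le : ∃ C : ℝ, 0 ≤ C ∧ ∀ H : ℕ, 1 ≤ H → ∀ β : ℝ, 0 < β → ∀ B : ℝ,
    ∀ Tc : ZdPlaquette 4 → Fin 4 → Fin 4 → Fin 4 → ℝ, (∀ p i j k, |Tc p i j k| ≤ B) → ∀ x₀ xT : Site 4,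
    ∀ s : ℝ, 0 ≤ s → ∀ D : Set (LandauFree H → E3), MeasurableSet D → D ⊆ smallField H s →
    ∀ τ : ℝ, gaussAvg β H (fun a => 1 - D.indicator (fun _ => (1 : ℝ)) a) ≤ τ → τ ≤ 1 / 2 →
    |Tilt.tiltCum4 ((((volume : Measure (LandauFree H → E3)).restrict D).withDensity fun a => ENNReal.ofReal (gaussWeight β H a)))
        (fun a => β * ∑ p ∈ plaquettesTouching (boxEdges 4 (2 * H + 1)), tripleForm (Tc p) (plaqVar H p.1 p.2.1.1 p.2.1.2 a)) 0
        (linCurvSq H (plaq12At x₀)) (linCurvSq H (plaq12At xT))| ≤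
      C * B ^ 2 * (1 + Real.log H) ^ 7 * (1 + Real.sqrt τ * (H : ℝ) ^ 4) / β ^ 3 := by
  obtain ⟨C₄, hC₄0, hC4⟩ := abs_cum4_linCurvSq_cubicPair_le
  obtain ⟨CV, hCV0, hV⟩ := gaussAvg_centred_linCurvSq_sq_le
  obtain ⟨CTB₀, hTB⟩ := tripleBond_gaussAvg_le
  refine ⟨C₄ + 313808 * CV * max CTB₀ 0, by positivity, fun H hH β hβ B Tc hT x₀ xT s hs0 D hDm hDs τ hτ hτ2 => ?_⟩
  classical
  set PT := plaquettesTouching (boxEdges 4 (2 * H + 1)) with hPT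
  have hL1 : 1 ≤ 1 + Real.log H := by
    have : (1 : ℝ) ≤ H := by exact_mod_cast hH
    have := Real.log_nonneg this; linarith
  have hL0 : 0 ≤ 1 + Real.log H := zero_le_one.trans hL1
  have hB0 : 0 ≤ B := (abs_nonneg _).trans (hT (((0 : Site 4), ⟨(0, 1), by decide⟩) : ZdPlaquette 4) 0 0 0)
  have hτ0 : 0 ≤ τ := le_trans (EdgeChartGaussian.gaussAvg_nonneg H hβ fun a => by
    by_cases ha : a ∈ D <;> simp [Set.indicator, ha]) hτ
  -- ### parity: `P` is odd, `L̃` is even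
  have hP0 : gaussAvg β H (fun a => β * ∑ p ∈ PT, tripleForm (Tc p) (plaqVar H p.1 p.2.1.1 p.2.1.2 a)) = 0 :=
    gaussAvg_eq_zero_of_odd β H fun a => tripleFormSum_neg H β PT Tc a
  have hLP : ∀ z : Site 4, gaussAvg β H (fun a => (linCurvSq H (plaq12At z) a - gaussAvg β H (linCurvSq H (plaq12At z))) *
      (β * ∑ p ∈ PT, tripleForm (Tc p) (plaqVar H p.1 p.2.1.1 p.2.1.2 a))) = 0 := fun z =>
    gaussAvg_mul_eq_zero_of_even_odd β H (fun a => by simp only [linCurvSq_neg]) fun a => tripleFormSum_neg H β PT Tc a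
  -- ### polynomial certificates
  have hcL : ∀ z : Site 4, ∃ Q : MvPolynomial (LandauFree H × Fin 3) ℝ, Q.totalDegree ≤ 2 ∧
      ∀ a, linCurvSq H (plaq12At z) a - gaussAvg β H (linCurvSq H (plaq12At z)) = MvPolynomial.eval (flatten (LandauFree H) a) Q := fun z =>
    polyCert_sub (polyCert_linCurvSq H _) (polyCert_const _ 2)
  have hcP := polyCert_tripleFormSum H β PT Tc hT
  -- ### the Gaussian sizes
  have ha₁ : ∀ z : Site 4, gaussAvg β H (fun a => (linCurvSq H (plaq12At z) a - gaussAvg β H (linCurvSq H (plaq12At z))) ^ 2) ≤ CV * (1 + Real.log H) ^ 2 / β ^ 2 :=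
    fun z => hV H hH β hβ _
  have ha₃ : gaussAvg β H (fun a => (β * ∑ p ∈ PT, tripleForm (Tc p) (plaqVar H p.1 p.2.1.1 p.2.1.2 a)) ^ 2) ≤
      max CTB₀ 0 * B ^ 2 * (H : ℝ) ^ 4 * (1 + Real.log H) ^ 3 / β := by
    refine (hTB H hH β hβ B Tc hT).trans ?_
    have : CTB₀ * B ^ 2 * (H : ℝ) ^ 4 * (1 + Real.log H) ^ 3 / β = CTB₀ * (B ^ 2 * (H : ℝ) ^ 4 * (1 + Real.log H) ^ 3 / β) := by ring
    rw [this, show max CTB₀ 0 * B ^ 2 * (H : ℝ) ^ 4 * (1 + Real.log H) ^ 3 / β = max CTB₀ 0 * (B ^ 2 * (H : ℝ) ^ 4 * (1 + Real.log H) ^ 3 / β) by ring]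
    exact mul_le_mul_of_nonneg_right (le_max_left _ _) (by positivity)
  obtain ⟨u, hu⟩ : ∃ u : ℝ, u = Real.sqrt (CV * (1 + Real.log H) ^ 2 / β ^ 2) := ⟨_, rfl⟩
  obtain ⟨v, hv⟩ : ∃ v : ℝ, v = Real.sqrt (max CTB₀ 0 * B ^ 2 * (H : ℝ) ^ 4 * (1 + Real.log H) ^ 3 / β) := ⟨_, rfl⟩
  have hu0 : 0 ≤ u := by rw [hu]; exact Real.sqrt_nonneg _
  have hv0 : 0 ≤ v := by rw [hv]; exact Real.sqrt_nonneg _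
  have hu2 : u ^ 2 = CV * (1 + Real.log H) ^ 2 / β ^ 2 := by rw [hu]; exact Real.sq_sqrt (by positivity)
  have hv2 : v ^ 2 = max CTB₀ 0 * B ^ 2 * (H : ℝ) ^ 4 * (1 + Real.log H) ^ 3 / β := by rw [hv]; exact Real.sq_sqrt (by positivity)
  have ha₁' : ∀ z : Site 4, gaussAvg β H (fun a => (linCurvSq H (plaq12At z) a - gaussAvg β H (linCurvSq H (plaq12At z))) ^ 2) ≤ u ^ 2 :=
    fun z => (ha₁ z).trans (le_of_eq hu2.symm)
  have ha₃' : gaussAvg β H (fun a => (β * ∑ p ∈ PT, tripleForm (Tc p) (plaqVar H p.1 p.2.1.1 p.2.1.2 a)) ^ 2) ≤ v ^ 2 :=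
    ha₃.trans (le_of_eq hv2.symm)
  -- Bonami–Nelson products
  have hnnL : ∀ z : Site 4, 0 ≤ gaussAvg β H (fun a => (linCurvSq H (plaq12At z) a - gaussAvg β H (linCurvSq H (plaq12At z))) ^ 2) :=
    fun z => EdgeChartGaussian.gaussAvg_nonneg H hβ fun a => sq_nonneg _
  have hnnP : 0 ≤ gaussAvg β H (fun a => (β * ∑ p ∈ PT, tripleForm (Tc p) (plaqVar H p.1 p.2.1.1 p.2.1.2 a)) ^ 2) :=
    EdgeChartGaussian.gaussAvg_nonneg H hβ fun a => sq_nonneg _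
  have H12 : gaussAvg β H (fun a => (linCurvSq H (plaq12At x₀) a - gaussAvg β H (linCurvSq H (plaq12At x₀))) ^ 2 *
      (linCurvSq H (plaq12At xT) a - gaussAvg β H (linCurvSq H (plaq12At xT))) ^ 2) ≤ 81 * (u ^ 2 * u ^ 2) := by
    refine (gaussAvg_sq_mul_sq_le_of_polyCert H hβ (hcL x₀) (hcL xT)).trans ?_
    rw [show ((3 : ℝ) ^ (2 + 2)) = 81 by norm_num, mul_assoc]
    exact mul_le_mul_of_nonneg_left (mul_le_mul (ha₁' x₀) (ha₁' xT) (hnnL xT) (sq_nonneg u)) (by norm_num)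
  have H13 : ∀ z : Site 4, gaussAvg β H (fun a => (linCurvSq H (plaq12At z) a - gaussAvg β H (linCurvSq H (plaq12At z))) ^ 2 *
      (β * ∑ p ∈ PT, tripleForm (Tc p) (plaqVar H p.1 p.2.1.1 p.2.1.2 a)) ^ 2) ≤ 243 * (u ^ 2 * v ^ 2) := by
    intro z
    refine (gaussAvg_sq_mul_sq_le_of_polyCert H hβ (hcL z) hcP).trans ?_
    rw [show ((3 : ℝ) ^ (2 + 3)) = 243 by norm_num, mul_assoc]
    exact mul_le_mul_of_nonneg_left (mul_le_mul (ha₁' z) ha₃' hnnP (sq_nonneg u)) (by norm_num)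
  have H33 : gaussAvg β H (fun a => (β * ∑ p ∈ PT, tripleForm (Tc p) (plaqVar H p.1 p.2.1.1 p.2.1.2 a)) ^ 2 *
      (β * ∑ p ∈ PT, tripleForm (Tc p) (plaqVar H p.1 p.2.1.1 p.2.1.2 a)) ^ 2) ≤ 729 * (v ^ 2 * v ^ 2) := by
    refine (gaussAvg_sq_mul_sq_le_of_polyCert H hβ hcP hcP).trans ?_
    rw [show ((3 : ℝ) ^ (3 + 3)) = 729 by norm_num, mul_assoc]
    exact mul_le_mul_of_nonneg_left (mul_le_mul ha₃' ha₃' hnnP (sq_nonneg v)) (by norm_num)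
  have hcLL := polyCert_mul (hcL x₀) (hcL xT)
  have hcP2 := polyCert_pow hcP 2
  have H123 : gaussAvg β H (fun a => ((linCurvSq H (plaq12At x₀) a - gaussAvg β H (linCurvSq H (plaq12At x₀))) *
      (linCurvSq H (plaq12At xT) a - gaussAvg β H (linCurvSq H (plaq12At xT)))) ^ 2 *
      (β * ∑ p ∈ PT, tripleForm (Tc p) (plaqVar H p.1 p.2.1.1 p.2.1.2 a)) ^ 2) ≤ 2187 * (81 * (u ^ 2 * u ^ 2) * v ^ 2) := by
    refine (gaussAvg_sq_mul_sq_le_of_polyCert H hβ hcLL hcP).trans ?_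
    rw [show ((3 : ℝ) ^ (2 + 2 + 3)) = 2187 by norm_num, mul_assoc]
    refine mul_le_mul_of_nonneg_left (mul_le_mul ?_ ha₃' hnnP (by positivity)) (by norm_num)
    refine le_trans (le_of_eq ?_) H12
    exact congrArg _ (funext fun a => by ring)
  have H133 : ∀ z : Site 4, gaussAvg β H (fun a => (linCurvSq H (plaq12At z) a - gaussAvg β H (linCurvSq H (plaq12At z))) ^ 2 *
      ((β * ∑ p ∈ PT, tripleForm (Tc p) (plaqVar H p.1 p.2.1.1 p.2.1.2 a)) ^ 2) ^ 2) ≤ 6561 * (u ^ 2 * (729 * (v ^ 2 * v ^ 2))) := by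
    intro z
    refine (gaussAvg_sq_mul_sq_le_of_polyCert H hβ (hcL z) hcP2).trans ?_
    rw [show ((3 : ℝ) ^ (2 + 2 * 3)) = 6561 by norm_num, mul_assoc]
    refine mul_le_mul_of_nonneg_left (mul_le_mul (ha₁' z) ?_ ?_ (sq_nonneg u)) (by norm_num)
    · refine le_trans (le_of_eq ?_) H33
      exact congrArg _ (funext fun a => by ring)
    · exact EdgeChartGaussian.gaussAvg_nonneg H hβ fun a => sq_nonneg _
  have H1233 : gaussAvg β H (fun a => ((linCurvSq H (plaq12At x₀) a - gaussAvg β H (linCurvSq H (plaq12At x₀))) *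
      (linCurvSq H (plaq12At xT) a - gaussAvg β H (linCurvSq H (plaq12At xT)))) ^ 2 *
      ((β * ∑ p ∈ PT, tripleForm (Tc p) (plaqVar H p.1 p.2.1.1 p.2.1.2 a)) ^ 2) ^ 2) ≤
      59049 * (81 * (u ^ 2 * u ^ 2) * (729 * (v ^ 2 * v ^ 2))) := by
    refine (gaussAvg_sq_mul_sq_le_of_polyCert H hβ hcLL hcP2).trans ?_
    rw [show ((3 : ℝ) ^ (2 + 2 + 2 * 3)) = 59049 by norm_num, mul_assoc]
    refine mul_le_mul_of_nonneg_left (mul_le_mul ?_ ?_ ?_ (by positivity)) (by norm_num)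
    · refine le_trans (le_of_eq ?_) H12
      exact congrArg _ (funext fun a => by ring)
    · refine le_trans (le_of_eq ?_) H33
      exact congrArg _ (funext fun a => by ring)
    · exact EdgeChartGaussian.gaussAvg_nonneg H hβ fun a => sq_nonneg _
  -- ### on-`D` bounds, measurability, integrability
  have mP : Measurable (fun a : LandauFree H → E3 => β * ∑ p ∈ PT, tripleForm (Tc p) (plaqVar H p.1 p.2.1.1 p.2.1.2 a)) :=
    measurable_of_polyCert hcP
  set BD : ℝ := 16 * s ^ 2 + β * PT.card * (6 * B * (4 * s) ^ 3) with hBD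
  have hBD0 : 0 ≤ BD := by positivity
  have hLD : ∀ z : Site 4, ∀ a ∈ D, |linCurvSq H (plaq12At z) a| ≤ BD := by
    intro z a ha
    have h1 := TiltSup.linCurvSq_le hs0 (hDs ha) z 1 2
    have h0 : 0 ≤ linCurvSq H (plaq12At z) a := Finset.sum_nonneg fun c _ => sq_nonneg _
    rw [abs_of_nonneg h0]
    have h2 : 0 ≤ β * PT.card * (6 * B * (4 * s) ^ 3) := by positivity
    exact h1.trans (by rw [hBD]; linarith)
  have hPD : ∀ a ∈ D, |β * ∑ p ∈ PT, tripleForm (Tc p) (plaqVar H p.1 p.2.1.1 p.2.1.2 a)| ≤ BD := by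
    intro a ha
    rw [abs_mul, abs_of_pos hβ]
    have hterm : ∀ p ∈ PT, |tripleForm (Tc p) (plaqVar H p.1 p.2.1.1 p.2.1.2 a)| ≤ 6 * B * (4 * s) ^ 3 := by
      intro p _
      refine (abs_tripleForm_le (Tc p) (hT p) _).trans ?_
      exact mul_le_mul_of_nonneg_left (pow_le_pow_left₀ (Finset.sum_nonneg fun i _ => norm_nonneg _)
        (TiltSup.sum_norm_plaqVar_le hs0 (hDs ha) p.1 p.2.1.1 p.2.1.2) 3) (by positivity)
    have hsum : |∑ p ∈ PT, tripleForm (Tc p) (plaqVar H p.1 p.2.1.1 p.2.1.2 a)| ≤ PT.card * (6 * B * (4 * s) ^ 3) := by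
      refine (Finset.abs_sum_le_sum_abs _ _).trans ?_
      refine (Finset.sum_le_sum hterm).trans (le_of_eq ?_)
      rw [Finset.sum_const, nsmul_eq_mul]
    have h16 : 0 ≤ 16 * s ^ 2 := by positivity
    calc β * |∑ p ∈ PT, tripleForm (Tc p) (plaqVar H p.1 p.2.1.1 p.2.1.2 a)| ≤ β * (PT.card * (6 * B * (4 * s) ^ 3)) :=
          mul_le_mul_of_nonneg_left hsum hβ.le
      _ ≤ BD := by rw [hBD]; linarith
  have iL : ∀ z : Site 4, Integrable (fun a : LandauFree H → E3 => linCurvSq H (plaq12At z) a ^ 8 * gaussWeight β H a) :=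
    fun z => integrable_polyCert_mul_gaussWeight H hβ (polyCert_pow (polyCert_linCurvSq H _) 8)
  have iP : Integrable (fun a : LandauFree H → E3 => (β * ∑ p ∈ PT, tripleForm (Tc p) (plaqVar H p.1 p.2.1.1 p.2.1.2 a)) ^ 8 * gaussWeight β H a) :=
    integrable_polyCert_mul_gaussWeight H hβ (polyCert_pow hcP 8)
  -- ### the transfer (✓`GaussRestrict.abs_tiltCum4_muSet_zero_sub_gaussAvg_centred_le`)
  have htr := GaussRestrict.abs_tiltCum4_muSet_zero_sub_gaussAvg_centred_le hβ hDm hτ hτ2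
    (measurable_linCurvSq H (plaq12At x₀)) (measurable_linCurvSq H (plaq12At xT)) mP hBD0 (hLD x₀) (hLD xT) hPD (iL x₀) (iL xT) iP
    (A₁ := u ^ 2) (A₂ := u ^ 2) (A₃ := v ^ 2) (A₁₂ := (9 * u ^ 2) ^ 2) (A₁₃ := (16 * u * v) ^ 2) (A₂₃ := (16 * u * v) ^ 2)
    (A₃₃ := (27 * v ^ 2) ^ 2) (A₁₂₃ := (421 * u ^ 2 * v) ^ 2) (A₁₃₃ := (2187 * u * v ^ 2) ^ 2) (A₂₃₃ := (2187 * u * v ^ 2) ^ 2)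
    (A₁₂₃₃ := (59049 * u ^ 2 * v ^ 2) ^ 2) (ha₁' x₀) (ha₁' xT) ?_ ?_ ?_ ?_ ?_ ?_ ?_ ?_ ?_
  · simp only [hP0, sub_zero, hLP, mul_zero] at htr
    rw [Real.sqrt_sq hu0, Real.sqrt_sq hv0, Real.sqrt_sq (by positivity : (0 : ℝ) ≤ 9 * u ^ 2),
      Real.sqrt_sq (by positivity : (0 : ℝ) ≤ 16 * u * v), Real.sqrt_sq (by positivity : (0 : ℝ) ≤ 27 * v ^ 2),
      Real.sqrt_sq (by positivity : (0 : ℝ) ≤ 421 * u ^ 2 * v), Real.sqrt_sq (by positivity : (0 : ℝ) ≤ 2187 * u * v ^ 2),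
      Real.sqrt_sq (by positivity : (0 : ℝ) ≤ 59049 * u ^ 2 * v ^ 2)] at htr
    have hTE : _ ≤ Real.sqrt τ * (313808 * (u ^ 2 * v ^ 2)) := htr.trans (le_of_eq (by ring))
    have h1 : _ ≤ Real.sqrt τ * (313808 * (u ^ 2 * v ^ 2)) := (abs_sub_abs_le_abs_sub _ _).trans hTE
    have hE4 := hC4 H hH β hβ B Tc hT x₀ xT
    have hu2v2 : u ^ 2 * v ^ 2 = CV * max CTB₀ 0 * B ^ 2 * (H : ℝ) ^ 4 * (1 + Real.log H) ^ 5 / β ^ 3 := by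
      rw [hu2, hv2]; field_simp
    have hL57 : (1 + Real.log (H : ℝ)) ^ 5 ≤ (1 + Real.log (H : ℝ)) ^ 7 := pow_le_pow_right₀ hL1 (by norm_num)
    have hstep : Real.sqrt τ * (313808 * (u ^ 2 * v ^ 2)) ≤
        313808 * CV * max CTB₀ 0 * B ^ 2 * (1 + Real.log H) ^ 7 * (Real.sqrt τ * (H : ℝ) ^ 4) / β ^ 3 := by
      rw [hu2v2]
      have hk : 0 ≤ Real.sqrt τ * (313808 * (CV * max CTB₀ 0 * B ^ 2 * (H : ℝ) ^ 4)) / β ^ 3 := by positivity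
      calc Real.sqrt τ * (313808 * (CV * max CTB₀ 0 * B ^ 2 * (H : ℝ) ^ 4 * (1 + Real.log H) ^ 5 / β ^ 3))
          = Real.sqrt τ * (313808 * (CV * max CTB₀ 0 * B ^ 2 * (H : ℝ) ^ 4)) / β ^ 3 * (1 + Real.log H) ^ 5 := by ring
        _ ≤ Real.sqrt τ * (313808 * (CV * max CTB₀ 0 * B ^ 2 * (H : ℝ) ^ 4)) / β ^ 3 * (1 + Real.log H) ^ 7 :=
            mul_le_mul_of_nonneg_left hL57 hk
        _ = _ := by ring
    have hx1 : 0 ≤ C₄ * B ^ 2 * (1 + Real.log H) ^ 7 * (Real.sqrt τ * (H : ℝ) ^ 4) / β ^ 3 := by positivity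
    have hx2 : 0 ≤ 313808 * CV * max CTB₀ 0 * B ^ 2 * (1 + Real.log H) ^ 7 / β ^ 3 := by positivity
    have hexp : (C₄ + 313808 * CV * max CTB₀ 0) * B ^ 2 * (1 + Real.log H) ^ 7 * (1 + Real.sqrt τ * (H : ℝ) ^ 4) / β ^ 3 =
        C₄ * B ^ 2 * (1 + Real.log H) ^ 7 / β ^ 3 + 313808 * CV * max CTB₀ 0 * B ^ 2 * (1 + Real.log H) ^ 7 * (Real.sqrt τ * (H : ℝ) ^ 4) / β ^ 3
          + (C₄ * B ^ 2 * (1 + Real.log H) ^ 7 * (Real.sqrt τ * (H : ℝ) ^ 4) / β ^ 3 + 313808 * CV * max CTB₀ 0 * B ^ 2 * (1 + Real.log H) ^ 7 / β ^ 3) := by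
      ring
    rw [hexp]
    calc _ ≤ Real.sqrt τ * (313808 * (u ^ 2 * v ^ 2)) + _ := sub_le_iff_le_add.mp h1
      _ ≤ 313808 * CV * max CTB₀ 0 * B ^ 2 * (1 + Real.log H) ^ 7 * (Real.sqrt τ * (H : ℝ) ^ 4) / β ^ 3 +
            C₄ * B ^ 2 * (1 + Real.log ↑H) ^ 7 / β ^ 3 := add_le_add hstep hE4
      _ = C₄ * B ^ 2 * (1 + Real.log ↑H) ^ 7 / β ^ 3 +
            313808 * CV * max CTB₀ 0 * B ^ 2 * (1 + Real.log H) ^ 7 * (Real.sqrt τ * (H : ℝ) ^ 4) / β ^ 3 := add_comm _ _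
      _ ≤ _ := le_add_of_nonneg_right (add_nonneg hx1 hx2)
  · simp only [hP0, sub_zero]
    exact ha₃'
  · calc _ = gaussAvg β H (fun a => (linCurvSq H (plaq12At x₀) a - gaussAvg β H (linCurvSq H (plaq12At x₀))) ^ 2 *
          (linCurvSq H (plaq12At xT) a - gaussAvg β H (linCurvSq H (plaq12At xT))) ^ 2) := congrArg _ (funext fun a => by ring)
      _ ≤ 81 * (u ^ 2 * u ^ 2) := H12
      _ = (9 * u ^ 2) ^ 2 := by ring
  · simp only [hP0, sub_zero]
    calc _ = gaussAvg β H (fun a => (linCurvSq H (plaq12At x₀) a - gaussAvg β H (linCurvSq H (plaq12At x₀))) ^ 2 *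
          (β * ∑ p ∈ PT, tripleForm (Tc p) (plaqVar H p.1 p.2.1.1 p.2.1.2 a)) ^ 2) := congrArg _ (funext fun a => by ring)
      _ ≤ 243 * (u ^ 2 * v ^ 2) := H13 x₀
      _ ≤ 256 * (u ^ 2 * v ^ 2) := mul_le_mul_of_nonneg_right (by norm_num) (mul_nonneg (sq_nonneg u) (sq_nonneg v))
      _ = (16 * u * v) ^ 2 := by ring
  · simp only [hP0, sub_zero]
    calc _ = gaussAvg β H (fun a => (linCurvSq H (plaq12At xT) a - gaussAvg β H (linCurvSq H (plaq12At xT))) ^ 2 *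
          (β * ∑ p ∈ PT, tripleForm (Tc p) (plaqVar H p.1 p.2.1.1 p.2.1.2 a)) ^ 2) := congrArg _ (funext fun a => by ring)
      _ ≤ 243 * (u ^ 2 * v ^ 2) := H13 xT
      _ ≤ 256 * (u ^ 2 * v ^ 2) := mul_le_mul_of_nonneg_right (by norm_num) (mul_nonneg (sq_nonneg u) (sq_nonneg v))
      _ = (16 * u * v) ^ 2 := by ring
  · simp only [hP0, sub_zero]
    calc _ = gaussAvg β H (fun a => (β * ∑ p ∈ PT, tripleForm (Tc p) (plaqVar H p.1 p.2.1.1 p.2.1.2 a)) ^ 2 *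
          (β * ∑ p ∈ PT, tripleForm (Tc p) (plaqVar H p.1 p.2.1.1 p.2.1.2 a)) ^ 2) := congrArg _ (funext fun a => by ring)
      _ ≤ 729 * (v ^ 2 * v ^ 2) := H33
      _ = (27 * v ^ 2) ^ 2 := by ring
  · simp only [hP0, sub_zero]
    calc _ = gaussAvg β H (fun a => ((linCurvSq H (plaq12At x₀) a - gaussAvg β H (linCurvSq H (plaq12At x₀))) *
          (linCurvSq H (plaq12At xT) a - gaussAvg β H (linCurvSq H (plaq12At xT)))) ^ 2 *
          (β * ∑ p ∈ PT, tripleForm (Tc p) (plaqVar H p.1 p.2.1.1 p.2.1.2 a)) ^ 2) := congrArg _ (funext fun a => by ring)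
      _ ≤ 2187 * (81 * (u ^ 2 * u ^ 2) * v ^ 2) := H123
      _ = 177147 * (u ^ 2 * u ^ 2 * v ^ 2) := by ring
      _ ≤ 177241 * (u ^ 2 * u ^ 2 * v ^ 2) :=
          mul_le_mul_of_nonneg_right (by norm_num) (mul_nonneg (mul_nonneg (sq_nonneg u) (sq_nonneg u)) (sq_nonneg v))
      _ = (421 * u ^ 2 * v) ^ 2 := by ring
  · simp only [hP0, sub_zero]
    calc _ = gaussAvg β H (fun a => (linCurvSq H (plaq12At x₀) a - gaussAvg β H (linCurvSq H (plaq12At x₀))) ^ 2 *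
          ((β * ∑ p ∈ PT, tripleForm (Tc p) (plaqVar H p.1 p.2.1.1 p.2.1.2 a)) ^ 2) ^ 2) := congrArg _ (funext fun a => by ring)
      _ ≤ 6561 * (u ^ 2 * (729 * (v ^ 2 * v ^ 2))) := H133 x₀
      _ = (2187 * u * v ^ 2) ^ 2 := by ring
  · simp only [hP0, sub_zero]
    calc _ = gaussAvg β H (fun a => (linCurvSq H (plaq12At xT) a - gaussAvg β H (linCurvSq H (plaq12At xT))) ^ 2 *
          ((β * ∑ p ∈ PT, tripleForm (Tc p) (plaqVar H p.1 p.2.1.1 p.2.1.2 a)) ^ 2) ^ 2) := congrArg _ (funext fun a => by ring)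
      _ ≤ 6561 * (u ^ 2 * (729 * (v ^ 2 * v ^ 2))) := H133 xT
      _ = (2187 * u * v ^ 2) ^ 2 := by ring
  · simp only [hP0, sub_zero]
    calc _ = gaussAvg β H (fun a => ((linCurvSq H (plaq12At x₀) a - gaussAvg β H (linCurvSq H (plaq12At x₀))) *
          (linCurvSq H (plaq12At xT) a - gaussAvg β H (linCurvSq H (plaq12At xT)))) ^ 2 *
          ((β * ∑ p ∈ PT, tripleForm (Tc p) (plaqVar H p.1 p.2.1.1 p.2.1.2 a)) ^ 2) ^ 2) := congrArg _ (funext fun a => by ring)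
      _ ≤ 59049 * (81 * (u ^ 2 * u ^ 2) * (729 * (v ^ 2 * v ^ 2))) := H1233
      _ = (59049 * u ^ 2 * v ^ 2) ^ 2 := by ring

end EdgeChartGaussian

end Summit.QuantumFields.YangMills.Theorems.AllWindowsColdBoxBoxHighLine

end
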